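import Mathlib
import Summits.PneNP.PneNP.Theorems.CnfIdealGenLengthRankDefectRepresentationsCutLemma
import Summits.PneNP.PneNP.Theorems.CnfIdealGenLengthRankDefectRepresentationsSimReduction

/-!
# Crux `RankDefectRepresentations` (stmt-PneNP-18923), line `rank-dehn-ladder`: DOUBLE CUT DOMINATION — the two-family cut
# lemma reduces to a two-dimensional max-cut decomposition (lead g8; `Lines/rank-dehn-ladder-g8.md` §8)

g7's cut lemma N1 (p642852) splits as (Part 1) CUT DOMINATION — every bipartition cut of a cube-coloured matrix is dominated by the
coordinate cuts (`bipartitionCut_le_sum_coordinateCuts`, p642076) — and (Part 2) MAX-CUT DECOMPOSITION — if all bipartition cuts have rank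
`≤ c` the matrix is within rank `4c` of a block-diagonal one (`exists_blockDiagonal_of_maxCut`, p642852).  For the TWO-FAMILY cut lemma
`TwoFamilyCutLemma` of `…SimReduction` (the hypothesis of the halving step `simBound_sum`), Part 1 carries over: applying cut domination
twice, once per family, every DOUBLE BIPARTITION CUT `μ(B,B′)` (entries whose rows and columns lie on different sides of `B` in the first
family of colours AND on different sides of `B′` in the second) is dominated by the mixed double coordinate cuts
(`doubleCut_le_sum`).  Hence `TwoFamilyCutLemma` follows from the purely two-dimensional statement `DoubleMaxCutDecomposition`
("all double bipartition cuts `≤ c` ⟹ `D = S_I + S_J + L`, `rank L ≤ λ c`") with `lam ↦ lam·n·n′` (`twoFamilyCutLemma_of_decomposition`).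
That 2D max-cut decomposition — g7's Part 2 one dimension up — is the recommended next statement item of the line (memo §8: the naive
extension of g7's class-move accounting loses `2^{n/2}`; the pattern is stable, so the triangular obstruction does not embed).
HONEST FRAMING: elementary; P ≠ NP is not moved; F-N2 is a FRONTIER formal rung.
-/

set_option linter.dupNamespace false -- `Summit.PneNP.PneNP.…`: summit = sub-problem name (D-0017)

namespace Summit.PneNP.PneNP.Theorems.CnfIdealGenLengthRankDefectRepresentationsTwoFamilyCutDomination

open Matrix
open Summit.PneNP.PneNP.Theorems.CnfIdealGenLengthRankDefectRepresentationsMergeLowerBound (rank_add_le' rank_sum_le')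
open Summit.PneNP.PneNP.Theorems.CnfIdealGenLengthRankDefectRepresentationsSimReduction (cut cut_comm TwoFamilyCutLemma)
open Summit.PneNP.PneNP.Theorems.CnfIdealGenLengthRankDefectRepresentationsCutLemma (rank_padBlock_eq)
open Summit.PneNP.PneNP.Theorems.CnfIdealGenLengthRankDefectRepresentationsCutLemmaCutDominationMatrix
  (bipartitionCut_le_sum_coordinateCuts)

variable {K : Type} [Field K] {n n' : ℕ}
variable {ι ι' : Type} [Fintype ι] [Fintype ι'] [DecidableEq ι] [DecidableEq ι']

section Defs

variable (row : ι → Fin n ⊕ Fin n' → Bool) (col : ι' → Fin n ⊕ Fin n' → Bool)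

/-- First-family colour of a row/column index. -/
abbrev colourI (c : Fin n ⊕ Fin n' → Bool) : Fin n → Bool := fun k => c (Sum.inl k)
/-- Second-family colour of a row/column index. -/
abbrev colourJ (c : Fin n ⊕ Fin n' → Bool) : Fin n' → Bool := fun k => c (Sum.inr k)

/-- The bipartition-cut mask of the SECOND family: keep entries whose row and column lie on different sides of `B′`. -/
def maskJ (B' : Finset (Fin n' → Bool)) (D : Matrix ι ι' K) : Matrix ι ι' K :=
  Matrix.of fun x y => if (colourJ (row x) ∈ B') ≠ (colourJ (col y) ∈ B') then D x y else 0

/-- The DOUBLE BIPARTITION CUT `μ(B,B′)`: the two `B`-off-diagonal blocks (first family) of the `B′`-cut matrix (second family). -/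
noncomputable def doubleCut (B : Finset (Fin n → Bool)) (B' : Finset (Fin n' → Bool)) (D : Matrix ι ι' K) : ℕ :=
  (Matrix.of fun x y => if colourI (row x) ∈ B ∧ colourI (col y) ∉ B then maskJ row col B' D x y else 0).rank +
  (Matrix.of fun x y => if colourI (row x) ∉ B ∧ colourI (col y) ∈ B then maskJ row col B' D x y else 0).rank

end Defs

section Domination

variable (row : ι → Fin n ⊕ Fin n' → Bool) (col : ι' → Fin n ⊕ Fin n' → Bool)

/-- The `B′`-mask is a sum of two padded blocks, so its rank is dominated by the coordinate cuts of the second family. -/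
theorem rank_maskJ_le (B' : Finset (Fin n' → Bool)) (N : Matrix ι ι' K) :
    (maskJ row col B' N).rank ≤ ∑ j : Fin n', (cut row col (Sum.inr j) N).rank := by
  classical
  have hsplit : maskJ row col B' N =
      (Matrix.of fun x y => if colourJ (row x) ∈ B' ∧ colourJ (col y) ∉ B' then N x y else 0) +
      (Matrix.of fun x y => if colourJ (row x) ∉ B' ∧ colourJ (col y) ∈ B' then N x y else 0) := by
    ext x y
    simp only [maskJ, Matrix.of_apply, Matrix.add_apply]
    by_cases h1 : colourJ (row x) ∈ B' <;> by_cases h2 : colourJ (col y) ∈ B' <;> simp [h1, h2]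
  rw [hsplit]
  refine (rank_add_le' _ _).trans ?_
  rw [rank_padBlock_eq (fun x => colourJ (row x)) (fun y => colourJ (col y)) N (· ∈ B') (· ∉ B'),
    rank_padBlock_eq (fun x => colourJ (row x)) (fun y => colourJ (col y)) N (· ∉ B') (· ∈ B')]
  have h := bipartitionCut_le_sum_coordinateCuts (K := K) (fun x => colourJ (row x)) (fun y => colourJ (col y)) N B'
  refine h.trans (le_of_eq ?_)
  rfl

omit [Fintype ι] [Fintype ι'] [DecidableEq ι] [DecidableEq ι'] in
/-- The first-family coordinate cut of a `B′`-masked matrix is the `B′`-mask of the coordinate cut (masks commute). -/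
theorem cutI_maskJ (B' : Finset (Fin n' → Bool)) (D : Matrix ι ι' K) (i : Fin n) :
    (Matrix.of fun x y => if colourI (row x) i ≠ colourI (col y) i then maskJ row col B' D x y else 0)
      = maskJ row col B' (cut row col (Sum.inl i) D) := by
  ext x y
  simp only [maskJ, cut, Matrix.of_apply, colourI]
  split_ifs <;> rfl

/-- **DOUBLE CUT DOMINATION.**  Every double bipartition cut is dominated by the mixed double coordinate cuts:
`μ(B,B′) ≤ Σ_{i,j} rank (cut_i cut_j D)`. -/
theorem doubleCut_le_sum (B : Finset (Fin n → Bool)) (B' : Finset (Fin n' → Bool)) (D : Matrix ι ι' K) :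
    doubleCut row col B B' D ≤ ∑ i : Fin n, ∑ j : Fin n', (cut row col (Sum.inl i) (cut row col (Sum.inr j) D)).rank := by
  classical
  unfold doubleCut
  rw [rank_padBlock_eq (fun x => colourI (row x)) (fun y => colourI (col y)) (maskJ row col B' D) (· ∈ B) (· ∉ B),
    rank_padBlock_eq (fun x => colourI (row x)) (fun y => colourI (col y)) (maskJ row col B' D) (· ∉ B) (· ∈ B)]
  have h := bipartitionCut_le_sum_coordinateCuts (K := K) (fun x => colourI (row x)) (fun y => colourI (col y))
    (maskJ row col B' D) B
  refine h.trans (Finset.sum_le_sum fun i _ => ?_)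
  have e : (Matrix.of fun x y =>
      if (fun x => colourI (row x)) x i ≠ (fun y => colourI (col y)) y i then maskJ row col B' D x y else 0)
      = maskJ row col B' (cut row col (Sum.inl i) D) := cutI_maskJ row col B' D i
  rw [e]
  refine (rank_maskJ_le row col B' _).trans (Finset.sum_le_sum fun j _ => ?_)
  rw [cut_comm]

end Domination

/-- **TWO-DIMENSIONAL MAX-CUT DECOMPOSITION** (OPEN; the recommended next statement item): if every double bipartition cut of `D`
has rank `≤ c`, then `D = S_I + S_J + L` with `S_I` supported on "first-family colours agree", `S_J` on "second-family colours agree"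
and `rank L ≤ λ c`.  (One family: g7's `exists_blockDiagonal_of_maxCut`, `λ = 4`.) -/
def DoubleMaxCutDecomposition (K : Type) [Field K] (n n' lam : ℕ) : Prop :=
  ∀ (ι ι' : Type) [Fintype ι] [Fintype ι'] [DecidableEq ι] [DecidableEq ι']
    (row : ι → Fin n ⊕ Fin n' → Bool) (col : ι' → Fin n ⊕ Fin n' → Bool) (D : Matrix ι ι' K) (c : ℕ),
    (∀ B B', doubleCut row col B B' D ≤ c) →
    ∃ SI SJ : Matrix ι ι' K,
      (∀ x y, (∃ k, row x (Sum.inl k) ≠ col y (Sum.inl k)) → SI x y = 0) ∧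
      (∀ x y, (∃ k', row x (Sum.inr k') ≠ col y (Sum.inr k')) → SJ x y = 0) ∧
      (D - SI - SJ).rank ≤ lam * c

/-- **The two-family cut lemma follows from the 2D max-cut decomposition** (with `λ ↦ λ n n′`), by double cut domination. -/
theorem twoFamilyCutLemma_of_decomposition {lam : ℕ} (h : DoubleMaxCutDecomposition K n n' lam) :
    TwoFamilyCutLemma K (Fin n) (Fin n') (lam * n * n') := by
  intro ι ι' _ _ _ _ row col D s hs
  have hμ : ∀ B B', doubleCut row col B B' D ≤ n * n' * s := by
    intro B B'
    refine (doubleCut_le_sum row col B B' D).trans ?_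
    calc ∑ i : Fin n, ∑ j : Fin n', (cut row col (Sum.inl i) (cut row col (Sum.inr j) D)).rank
        ≤ ∑ _i : Fin n, ∑ _j : Fin n', s := Finset.sum_le_sum fun i _ => Finset.sum_le_sum fun j _ => hs i j
      _ = n * n' * s := by simp [mul_assoc]
  obtain ⟨SI, SJ, hSI, hSJ, hL⟩ := h ι ι' row col D (n * n' * s) hμ
  refine ⟨SI, SJ, hSI, hSJ, hL.trans (le_of_eq ?_)⟩
  ring

end Summit.PneNP.PneNP.Theorems.CnfIdealGenLengthRankDefectRepresentationsTwoFamilyCutDomination
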